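import Summits.QuantumFields.YangMills.Theorems.BalabanUVNodesN12NearFlatFederbushFibre
import Summits.QuantumFields.YangMills.Theorems.BalabanUVNodesN12FlatChartDerivIterLin

/-!
# BalabanUVNodes ∕ N12 — THE FEDERBUSH FIBRE LETTER IN CHART CURRENCY: from «`DΦ♭(0) w′ = y`» (`Φ♭ = msChart F N K k 𝐁 (M˙1) 1`, n07-w2's canonical
# multi-scale chart at the flat configuration) to the reproduction of the slice datum on the region, hence the `hm` binder of the near-flat one-sided (1.7)
# skeleton in the EXACT shape `∀ w′, L♭ w′ = y → m ≤ B♭ w′ w′` with `L♭ := fderiv ℝ Φ♭ 0`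

Cell `pub-ymgap` (HUMAN RULINGS D-0062 ∕ D-0149), width seat `pub-ymgap-dag-n12-w4` g2 (U2c lane; sequel of this seat's `…N12NearFlatFederbushFibre`); the dictionary step the
prequel left to «the consumer» — typed here so that the skeleton's binder is met verbatim.  Key K1⁷ `stmt-QuantumFields-20542`, `--kind proof --supports … --as helper`;
count-neutral; THEOREMS ONLY (0 `def`, 0 `sorry`, 0 `instance`).  CONSUMED BY NAME, nothing restated: dag-n10-w1's (J-b) B `N12FlatChartDerivIterLin.fderiv_msChart_one_apply_eq_iterLin`
∕ `iterLin_mem_lieSU` (p594415), n07-w2's `Node00.MultiScaleFibreChart` letters (`msChart`, `constrEnum`, `coe_suProj_of_mem`), this seat's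
`N12NearFlatFederbushFibre.gamma0_circ_le_flatHessian_of_reproduce` (INTENT-7).

THE PRINT.  [Balaban1985Variational] (44)–(48) p. 285 (the linearised multi-scale constraint and «L^jηQ_jHB = B on Λ_j» (45)); [Balaban1988Convergent] (2.10)–(2.12) p. 256
(the determining set `𝐁` and its constrained bonds); [Balaban1989LargeFieldII] (1.7) p. 358.

CONTENTS.
§1 ★ `iterLin_eq_of_fderiv_msChart_one_eq` — if `DΦ♭(0) w′ = y` then at every level-`k` constrained bond `b` of `𝐁` the k-fold linearised average of `w′` IS the datum:
   `(Q^{(k)}↑w′)(b) = ↑(y_{(k,b)})` (B's componentwise identity at the index of `(k, b)`, `π = id` on `𝔰𝔲(N)`).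
§2 ★★ `reproduce_of_fderiv_msChart_one_eq` — the prequel's antecedent `hrep` on a region `S_k` whose `(e₀, e_ν)`-plaquette bonds are level-`k` constrained bonds of `𝐁`
   carrying the datum values `φ(ιA X b)`; ★★★ `hm_federbush_of_fderiv_msChart_one_eq` — the skeleton's binder VERBATIM:
   `∀ w′, fderiv ℝ Φ♭ 0 w′ = y → ((L^d)^k∕(L²L²)^k)·circ(X) ≤ D²(A∘expChart 1)(0)(w′,w′)`.

HONEST FRAMING.  Bookkeeping by name; the two geometric dictionary hypotheses (the region's plaquette bonds are constrained at level `k`; the datum velocity `y` carries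
`φ(ιA X)` there) are DISPLAYED — at the record they are the endpoint's window-inside-`Z` geometry (`hZ`) and the definition of the datum map; nothing of Bałaban's
asserted; N12 NOT discharged; K1⁷ NOT closed; count-neutral (typed 28∕28 · discharged 5∕27 unmoved); one finite 𝕋⁴ programme at fixed ε — R4 closes the conditional
rung `BalabanLadder.UV` only; the YM mass gap (Clay) is NOT proved by any of this.  No `sorry`, no `def`, no `instance`, no `notation`.
-/

noncomputable section

open scoped BigOperators Matrix.Norms.L2Operator
open Finset

namespace Summit.QuantumFields.YangMills.BalabanUVNodes.N12NearFlatFederbushFibreChart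

open Literature.MathematicalPhysics.QuantumFieldTheory.Balaban1983to89
open Literature.MathematicalPhysics.QuantumLattice (quatMatrix)
open T4Continuum (T4Family)
open T4HaarSU2ExpChart (imQuat)
open T4AdjointCovarianceUnitary (lieSU)
open B15DeterminingSets GaugeField
open B15Prop1SliceCoordinates (GaugeSlice ιA)
open T4AxialGaugeSmallField (castSite)
open B6TreeGaugePoincare (curl)
open B16Eq18Proof (box)
open LatticeFieldCalculus (runSite)
open BlockAveragingEMLLinearised (linAvg)
open Node00
open Summit.QuantumFields.YangMills.BalabanUVNodes.N12FlatChartDerivIterLin (fderiv_msChart_one_apply_eq_iterLin iterLin_mem_lieSU)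
open Summit.QuantumFields.YangMills.BalabanUVNodes.N12NearFlatFederbushFibre (gamma0_circ_le_flatHessian_of_reproduce)

variable {F : T4Family} {N : ℕ} [NeZero N] {K k : ℕ}

/-! ## §1  At a level-`k` constrained bond, `DΦ♭(0) w′ = y` says `(Q^{(k)}↑w′)(b) = ↑y_{(k,b)}` -/

/-- ★ **THE DATUM IS REPRODUCED AT EVERY LEVEL-`k` CONSTRAINED BOND**: if `DΦ♭(0) w′ = y` for the flat multi-scale chart `Φ♭ = msChart F N K k 𝐁 (M˙1) 1`, then for every
bond `b` of level `k` meeting `Γ_k = 𝐁 k` the k-fold linearised average of `w′` at `b` equals the datum component at the index of `(k, b)`, as matrices (B's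
`fderiv_msChart_one_apply_eq_iterLin` at that index; `π` is the identity on the `𝔰𝔲(N)`-valued `Q^{(k)}↑w′`). [cite: Balaban1985Variational, (45) p.285; Balaban1988Convergent, (2.10) p.256] -/
theorem iterLin_eq_of_fderiv_msChart_one_eq
    (Q : (i : ℕ) → (PBond (F.P K) 0 → Matrix (Fin N) (Fin N) ℂ) → PBond (F.P K) i → Matrix (Fin N) (Fin N) ℂ)
    (hQ0 : ∀ Y, Q 0 Y = Y) (hQs : ∀ (i : ℕ) (Y : PBond (F.P K) 0 → Matrix (Fin N) (Fin N) ℂ) (c : PBond (F.P K) (i + 1)), Q (i + 1) Y c = linAvg (Q i Y) c)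
    (𝔹 : DetSet (F.P K)) (w' : PBond (F.P K) 0 → lieSU (Fin N)) {y : Fin (constrCard 𝔹 k) → lieSU (Fin N)}
    (hD : fderiv ℝ (msChart F N K k 𝔹 (avgFamily (avOfRecord F N K) (1 : GaugeField (F.P K) 0 (SU N))) (1 : GaugeField (F.P K) 0 (SU N))) 0 w' = y)
    (b : PBond (F.P K) k) (hb : b ∈ bondsOf (𝔹 k)) :
    Q k (fun c => (w' c : Matrix (Fin N) (Fin N) ℂ)) b = ((y (constrEnum 𝔹 k ⟨Fin.last k, ⟨b, hb⟩⟩) : lieSU (Fin N)) : Matrix (Fin N) (Fin N) ℂ) := by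
  set i : Fin (constrCard 𝔹 k) := constrEnum 𝔹 k ⟨Fin.last k, ⟨b, hb⟩⟩ with hi_def
  have hi : (constrEnum 𝔹 k).symm i = ⟨Fin.last k, ⟨b, hb⟩⟩ := Equiv.symm_apply_apply _ _
  have h := fderiv_msChart_one_apply_eq_iterLin Q hQ0 hQs 𝔹 w' i
  -- transport the index `(j, c) = e.symm i` to `(k, b)` along `hi` (dependent pair: by substitution)
  have hgen : ∀ x : ConstrSet 𝔹 k, x = ⟨Fin.last k, ⟨b, hb⟩⟩ →
      suProj N (Q ((x.1 : ℕ)) (fun c => (w' c : Matrix (Fin N) (Fin N) ℂ)) x.2.1) = suProj N (Q k (fun c => (w' c : Matrix (Fin N) (Fin N) ℂ)) b) := by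
    rintro x rfl
    rfl
  have h' : fderiv ℝ (msChart F N K k 𝔹 (avgFamily (avOfRecord F N K) (1 : GaugeField (F.P K) 0 (SU N))) (1 : GaugeField (F.P K) 0 (SU N))) 0 w' i
      = suProj N (Q k (fun c => (w' c : Matrix (Fin N) (Fin N) ℂ)) b) := h.trans (hgen _ hi)
  rw [hD] at h'
  have hmem : Q k (fun c => (w' c : Matrix (Fin N) (Fin N) ℂ)) b ∈ lieSU (Fin N) := iterLin_mem_lieSU Q hQ0 hQs (fun c => (w' c).2) k b
  rw [h', coe_suProj_of_mem hmem]

/-! ## §2  The reproduction on the region and the `hm` binder verbatim -/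

section Binder

variable [DecidableEq (PBond (F.P K) k)]

/-- ★★ **THE REGION ANTECEDENT OF THE FIBRE LETTER FROM THE CHART**: if the four bonds of every `(e₀, e_ν)`-plaquette at the sites of the region `S_k` are level-`k` constrained bonds
of `𝐁` (at the record: the window lies inside `Z`, `hZ`) and the datum velocity `y` carries `φ(ιA X b)` at their indices (the definition of the datum map), then
`DΦ♭(0) w′ = y` gives the reproduction `(Q^{(k)}↑w′)(b) = ↑φ(ιA X b)` on those bonds — the `hrep` of `N12NearFlatFederbushFibre`. [cite: Balaban1985Variational, (45) p.285; Balaban1989LargeFieldII, (1.7) p.358] -/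
theorem reproduce_of_fderiv_msChart_one_eq (h0 : 0 < (F.P K).d)
    (Q : (i : ℕ) → (PBond (F.P K) 0 → Matrix (Fin 2) (Fin 2) ℂ) → PBond (F.P K) i → Matrix (Fin 2) (Fin 2) ℂ)
    (hQ0 : ∀ Y, Q 0 Y = Y) (hQs : ∀ (i : ℕ) (Y : PBond (F.P K) 0 → Matrix (Fin 2) (Fin 2) ℂ) (c : PBond (F.P K) (i + 1)), Q (i + 1) Y c = linAvg (Q i Y) c)
    (𝔹 : DetSet (F.P K)) {S : Set (Site (F.P K) k)} {T : Finset (PBond (F.P K) k)} (X : GaugeSlice S T (EuclideanSpace ℝ (Fin 3)))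
    {φ : EuclideanSpace ℝ (Fin 3) →ₗ[ℝ] lieSU (Fin 2)} (Sk : Finset (Site (F.P K) k))
    (hcons : ∀ (ν : Fin (F.P K).d), ∀ s ∈ Sk, (⟨s, ⟨0, h0⟩⟩ : PBond (F.P K) k) ∈ bondsOf (𝔹 k) ∧ (⟨s.shift ⟨0, h0⟩, ν⟩ : PBond (F.P K) k) ∈ bondsOf (𝔹 k) ∧
      (⟨s.shift ν, ⟨0, h0⟩⟩ : PBond (F.P K) k) ∈ bondsOf (𝔹 k) ∧ (⟨s, ν⟩ : PBond (F.P K) k) ∈ bondsOf (𝔹 k))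
    {y : Fin (constrCard 𝔹 k) → lieSU (Fin 2)}
    (hy : ∀ (b : PBond (F.P K) k) (hb : b ∈ bondsOf (𝔹 k)), y (constrEnum 𝔹 k ⟨Fin.last k, ⟨b, hb⟩⟩) = φ (ιA S T X b))
    (w' : PBond (F.P K) 0 → lieSU (Fin 2))
    (hD : fderiv ℝ (msChart F 2 K k 𝔹 (avgFamily (avOfRecord F 2 K) (1 : GaugeField (F.P K) 0 (SU 2))) (1 : GaugeField (F.P K) 0 (SU 2))) 0 w' = y) :
    ∀ (ν : Fin (F.P K).d), ∀ s ∈ Sk,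
      Q k (fun b => (w' b : Matrix (Fin 2) (Fin 2) ℂ)) ⟨s, ⟨0, h0⟩⟩ = ((φ (ιA S T X ⟨s, ⟨0, h0⟩⟩) : lieSU (Fin 2)) : Matrix (Fin 2) (Fin 2) ℂ) ∧
      Q k (fun b => (w' b : Matrix (Fin 2) (Fin 2) ℂ)) ⟨s.shift ⟨0, h0⟩, ν⟩ = ((φ (ιA S T X ⟨s.shift ⟨0, h0⟩, ν⟩) : lieSU (Fin 2)) : Matrix (Fin 2) (Fin 2) ℂ) ∧
      Q k (fun b => (w' b : Matrix (Fin 2) (Fin 2) ℂ)) ⟨s.shift ν, ⟨0, h0⟩⟩ = ((φ (ιA S T X ⟨s.shift ν, ⟨0, h0⟩⟩) : lieSU (Fin 2)) : Matrix (Fin 2) (Fin 2) ℂ) ∧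
      Q k (fun b => (w' b : Matrix (Fin 2) (Fin 2) ℂ)) ⟨s, ν⟩ = ((φ (ιA S T X ⟨s, ν⟩) : lieSU (Fin 2)) : Matrix (Fin 2) (Fin 2) ℂ) := by
  intro ν s hs
  obtain ⟨h1, h2, h3, h4⟩ := hcons ν s hs
  refine ⟨?_, ?_, ?_, ?_⟩
  · rw [iterLin_eq_of_fderiv_msChart_one_eq Q hQ0 hQs 𝔹 w' hD _ h1, hy _ h1]
  · rw [iterLin_eq_of_fderiv_msChart_one_eq Q hQ0 hQs 𝔹 w' hD _ h2, hy _ h2]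
  · rw [iterLin_eq_of_fderiv_msChart_one_eq Q hQ0 hQs 𝔹 w' hD _ h3, hy _ h3]
  · rw [iterLin_eq_of_fderiv_msChart_one_eq Q hQ0 hQs 𝔹 w' hD _ h4, hy _ h4]

/-- ★★★ **THE `hm` BINDER OF THE NEAR-FLAT SKELETON, VERBATIM, AT THE FLAT MULTI-SCALE CHART**: with `L♭ := fderiv ℝ Φ♭ 0` (`Φ♭ = msChart F 2 K k 𝐁 (M˙1) 1`),
`B♭ := D²(A∘expChart 1)(0)` and `m := ((L^d)^k∕(L²L²)^k)·circ(X)`: under the prequel's window ∕ nested-region binders with top region `S_k`, the region's plaquette bonds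
constrained at level `k` and the datum velocity `y` carrying `φ(ιA X)` there,
`∀ w′, L♭ w′ = y → m ≤ B♭ w′ w′` — [LF-II] (1.7) at the flat background over the WHOLE flat linearised fibre of `y`, in the exact shape of
`B16Ineq17NearFlatOneSidedSeminorm.lagrangeHessian_ge_flatMin_sub_seminorm`'s `hm`. [cite: Balaban1989LargeFieldII, (1.7) pp.357–358; Balaban1984PropagatorsI, (1.64)–(1.67) p.29; Balaban1985Variational, (44)–(48) p.285] -/
theorem hm_federbush_of_fderiv_msChart_one_eq (h0 : 0 < (F.P K).d) (hk : k ≤ (F.P K).m + (F.P K).K)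
    (Q : (i : ℕ) → (PBond (F.P K) 0 → Matrix (Fin 2) (Fin 2) ℂ) → PBond (F.P K) i → Matrix (Fin 2) (Fin 2) ℂ)
    (hQ0 : ∀ Y, Q 0 Y = Y) (hQs : ∀ (i : ℕ) (Y : PBond (F.P K) 0 → Matrix (Fin 2) (Fin 2) ℂ) (c : PBond (F.P K) (i + 1)), Q (i + 1) Y c = linAvg (Q i Y) c)
    (𝔹 : DetSet (F.P K)) {S : Set (Site (F.P K) k)} {T : Finset (PBond (F.P K) k)} (X : GaugeSlice S T (EuclideanSpace ℝ (Fin 3)))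
    {m : Fin (F.P K).d → ℕ} (lo : Fin (F.P K).d → ℤ) (hm : ∀ κ, (m κ : ℤ) ≤ (F.P K).sitesPerDir k)
    (Sset : (i : ℕ) → Finset (Site (F.P K) i)) (hwin : ∀ z ∈ box m lo, (castSite z : Site (F.P K) k) ∈ Sset k)
    (hS : ∀ (ν : Fin (F.P K).d), (⟨0, h0⟩ : Fin (F.P K).d) ≠ ν → ∀ i, i < k → ∀ y ∈ Sset (i + 1), ∀ (r : Fin (F.P K).d → Fin (F.P K).L) (s t : ℕ),
      s < (F.P K).L → t < (F.P K).L → runSite (runSite (Site.blockSite y r) ⟨0, h0⟩ s) ν t ∈ Sset i)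
    {φ : EuclideanSpace ℝ (Fin 3) →ₗ[ℝ] lieSU (Fin 2)} (hφ : ∀ v, ((φ v : lieSU (Fin 2)) : Matrix (Fin 2) (Fin 2) ℂ) = quatMatrix (imQuat v))
    (hcons : ∀ (ν : Fin (F.P K).d), ∀ s ∈ Sset k, (⟨s, ⟨0, h0⟩⟩ : PBond (F.P K) k) ∈ bondsOf (𝔹 k) ∧ (⟨s.shift ⟨0, h0⟩, ν⟩ : PBond (F.P K) k) ∈ bondsOf (𝔹 k) ∧
      (⟨s.shift ν, ⟨0, h0⟩⟩ : PBond (F.P K) k) ∈ bondsOf (𝔹 k) ∧ (⟨s, ν⟩ : PBond (F.P K) k) ∈ bondsOf (𝔹 k))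
    {y : Fin (constrCard 𝔹 k) → lieSU (Fin 2)}
    (hy : ∀ (b : PBond (F.P K) k) (hb : b ∈ bondsOf (𝔹 k)), y (constrEnum 𝔹 k ⟨Fin.last k, ⟨b, hb⟩⟩) = φ (ιA S T X b)) :
    ∀ w' : PBond (F.P K) 0 → lieSU (Fin 2),
      fderiv ℝ (msChart F 2 K k 𝔹 (avgFamily (avOfRecord F 2 K) (1 : GaugeField (F.P K) 0 (SU 2))) (1 : GaugeField (F.P K) 0 (SU 2))) 0 w' = y →
      (((F.P K).L : ℝ) ^ (F.P K).d) ^ k / ((((F.P K).L : ℝ)) ^ 2 * ((F.P K).L : ℝ) ^ 2) ^ k *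
          ∑ z ∈ box m lo, ∑ μ : Fin (F.P K).d, ∑ a : Fin 3, curl (fun b => ιA S T X (⟨castSite b.1, b.2⟩ : PBond (F.P K) k) a) z ⟨0, h0⟩ μ ^ 2
        ≤ fderiv ℝ (fun Y => fderiv ℝ (fun Y : PBond (F.P K) 0 → lieSU (Fin 2) => wilsonAction4 (expChart (1 : GaugeField (F.P K) 0 (SU 2)) Y)) Y) 0 w' w' :=
  fun w' hD => gamma0_circ_le_flatHessian_of_reproduce h0 hk X lo hm Sset hwin hS Q hQ0 hQs hφ w'
    (reproduce_of_fderiv_msChart_one_eq h0 Q hQ0 hQs 𝔹 X (Sset k) hcons hy w' hD)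

end Binder

end Summit.QuantumFields.YangMills.BalabanUVNodes.N12NearFlatFederbushFibreChart

end
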